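import Literature.IUT.HodgeArakelov.BadPrimeGaussianMonoidsCor36GenuineRecordFamilyAct
import Literature.IUT.HodgeArakelov.BadPrimeGaussianMonoidsCor36GenuineRecordFamilyOfTower
import Literature.IUT.HodgeArakelov.BadPrimeGaussianMonoidsGenuineRecordOrbitOfTower

/-!
# [IUTchII] Cor 3.6 (ii) «↷» at the genuine `θ_env` data with PRINT'S constant monoid `O := 𝒪^▷_{ℚ̄_p}` through `ε`, with the labelled
# copies identified through EQUALITY OF COEFFICIENT ACTIONS (repair of GAP-LEDGER G-w4d004-1, part 10: abc-iut-w5-d192's p436909 and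
# this seat's p441065 capstone re-pointed; proof-only)

S. Mochizuki, *Inter-universal Teichmüller theory II*, kurims Dec-2020 manuscript, Cor 3.6 (ii) p. 100 l. 23–26, Cor 3.6 (i) p. 99
l. 40–47, Cor 3.5 (i)/(ii) pp. 94–95 («the inclusions `G_v(M^Θ_*) ↪ Π_{v▶}(M^Θ_*▶)` determined by the various choices of the
`D^δ_{t,μ_-}`»), Ex 1.1 p. 111 / IUTchI Ex 3.2–3.3 (`O^▷ = 𝒪^▷_{ℚ̄_p}`) [cite: Mochizuki2012, Cor 3.6 (ii) p.100]; [EtTh] Cor 2.19 (ii) p. 64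
(refereed). Claim key DISPUTED (D-0012); nothing disputed is asserted here. PROOF-ONLY companion (abc-iut cell, layer L6, seat
abc-iut-w4-d004 gen 4; node **IUTchII:Cor3.6(ii)** «↷», sub-DAG row Cor-36.ii.r9; finding F-w4d004-g4-1 / GAP-LEDGER G-w4d004-1).
NO definition, NO `Prop` fact, NO instance.

§1 = abc-iut-w5-d192's `cor36ii_psi_toRecord_family_nonzeroIntegers_of_mem_thetaEnv` /
`cor36ii_infty_toRecord_family_nonzeroIntegers_of_cyclotomeTower_rigid` (p436909) and §2 = this seat's
`cor36ii_infty_toRecord_family_nonzeroIntegers_pairRhoLim` (p441065) VERBATIM except that the restriction of label `t` is pinned to the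
action-level pull-back `h1LimComapAct … (s_t) … φ₀ (hφAct t)` (abc-iut-w4-d004 `CohomologyLimitComapAct`, p444771) under
`hφAct : ∀ t g (a : l·Δ_Θ), conj(phi(s_t g)) a = conj(φ₀ g) a` — equality of coefficient ACTIONS, which HOLDS at the genuine data for the
very sections of `ε` these theorems take (`EtaleLevels.hφAct_of_aug_eq`, p445588, from `hsec`) — in place of the homomorphism equality
`hφ : ∀ t, phi ∘ s_t = φ₀` that ≥ 2 distinct labels cannot meet: **`cor36ii_psi_toRecord_act_family_nonzeroIntegers_of_mem_thetaEnv`**,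
**`cor36ii_infty_toRecord_act_family_nonzeroIntegers_of_cyclotomeTower_rigid`**, **`cor36ii_infty_toRecord_act_family_nonzeroIntegers_pairRhoLim`**
(junctions: `…Cor36GenuineRecordFamilyAct`). HONEST FRAMING: no side taken on [IUTchIII] Cor 3.12; typed ≠ proved ≠ endorsed.
-/

noncomputable section

namespace Literature.IUT.HodgeArakelov

namespace EtaleLevels

open Literature.AnabelianGeometry.EtaleTheta CohomologySystemOfContH1 EtaleThetaDataOfSetting TemperedThetaMonoids
  BadPrimeGaussianMonoids Literature.AnabelianGeometry.AbsoluteAnabelian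

/-! ### §1. Any inversion family (abc-iut-w5-d192's p436909, action-level junction) -/

section TowerAct

variable {p : ℕ} [Fact p.Prime] {D : Literature.AnabelianGeometry.EtaleTheta.ThetaSetting p}
  {E : D.EtaleThetaData} {l : ℕ} (C : E.DoubleUnderline l) (hC : D.Compat) (hS : D.Sec2Hyps)
  (hl : l.Prime) (hp2 : p ≠ 2) (hpl : p ≠ l) (hζ : ∃ ζ : D.K, IsPrimitiveRoot ζ (4 * l))
  (mods : ∀ M : ℕ+, D.CyclotomeMod l M)
  (f : contCocycles D.toTheta D.DeltaTheta C.GtpYdduu) (hf : f ∈ C.rootCocycles hC)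
  (hmods : ∀ (M M' : ℕ+) (h : (M : ℕ) ∣ (M' : ℕ)) (x : D.lDeltaTheta l),
    MuN.red p M M' h ((mods M').red x) = (mods M).red x)
  (h15 : Literature.AnabelianGeometry.EtaleTheta.ThetaSetting.Prop15iii E hC) (L : C.CuspLabels)
  (hZ : ∀ M : ℕ+, Nonempty (ModelCyclotomes.lDeltaQuot (C.rigidData (mods M) hC hS h15 L) ≃*
    Literature.IUT.HodgeTheaters.ZHat))
  (hcharY : EtaleThetaDataOfSetting.PiYddCharacteristic C)
  (hlim : Function.Bijective (rigidLimHom C hC hS hl hp2 hpl hζ mods f hf hmods h15 L hZ))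
  [(EtaleThetaDataOfSetting.PiYdd C).Normal]
  (c : CyclotomeCoefficients (phi C) (D.lDeltaTheta l) (PadicAlgCl p)ˣ)
  {Iota : Type}
  (iota : Iota → ((thetaEnvData C hC hS hl hp2 hpl hζ mods f hf hmods h15 L hZ hcharY hlim).D.coh.lim ≃+
    (thetaEnvData C hC hS hl hp2 hpl hζ mods f hf hmods h15 L hZ hcharY hlim).D.coh.lim))
  {Lbl : Type*} {P₀ : TopGroup.{0}} (φ₀ : P₀ →* D.GtpTheta) (s : Lbl → (P₀ →* Pi C))
  (hι : ∀ t, Continuous ((MonoidHom.id (Pi C)).comp (s t)))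
  (hN : ∀ t, (⊤ : Subgroup P₀).map ((MonoidHom.id (Pi C)).comp (s t)) ≤ PiYdd C)
  -- THE ACTION-LEVEL JUNCTION (replaces `hφ : ∀ t, (phi C).comp (s t) = φ₀`)
  (hφAct : ∀ (t : Lbl) (g : P₀) (a : D.lDeltaTheta l),
    MulAut.conjNormal (phi C (((MonoidHom.id (Pi C)).comp (s t)) g)) a = MulAut.conjNormal (φ₀ g) a)

/-- **[IUTchII] Cor 3.6 (ii) «↷», `Ψ`-LEVEL, at the genuine `θ_env` data with ANY inversion family `iota` and print's constant
monoid `O := 𝒪^▷_{ℚ̄_p} ≤ ℚ̄_pˣ` through `ε`** (`hO`, `hq` DISCHARGED; `q := ε`): for every family of continuous evaluation sections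
`s_t : Π₀ → Π^tp_{X̲̲}` landing in `Π^tp_{Ÿ̲̲}`, with common coefficient action `φ₀`, that are sections of `ε` up to one identification
`w : Π₀ → G_{ℚ_p}` (`ε ∘ s_t = w`), every `θ ∈ θ^{i₀}_env(𝕄_*)` and every tuple `x : Lbl → 𝒪^▷_{ℚ̄_p}` whose labeled Kummer classes lie
in `Ψ_ξ(θ)`: the translated tuple `(s_t(g) · x_t)_t` has its labeled Kummer classes in `Ψ_ξ(θ)` again.
[claim: Mochizuki2012, status: disputed] (IUTchII §3 Cor 3.6 (ii), kurims p.100) -/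
theorem cor36ii_psi_toRecord_act_family_nonzeroIntegers_of_mem_thetaEnv
    (w : P₀ →* Literature.AnabelianGeometry.SemiGraphs.GQp p)
    (hsec : ∀ t g, aug C (s t g) = w g) {i₀ : Iota}
    {θ : ((thetaEnvData C hC hS hl hp2 hpl hζ mods f hf hmods h15 L hZ hcharY hlim).toRecord
          (h1LimConjMulAut (phi C) (D.lDeltaTheta l) (PiYdd C)) (h1LimKummerOn (phi C) (D.lDeltaTheta l) (PiYdd C) c
            (isOpen_stabilizer_units C) (finiteIndex_stabilizer_units C) ((nonzeroIntegers ℚ_[p] (PadicAlgCl p)).comap (Units.coeHom (PadicAlgCl p))))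
          iota).H}
    (hθ : θ ∈ ((thetaEnvData C hC hS hl hp2 hpl hζ mods f hf hmods h15 L hZ hcharY hlim).toRecord
          (h1LimConjMulAut (phi C) (D.lDeltaTheta l) (PiYdd C)) (h1LimKummerOn (phi C) (D.lDeltaTheta l) (PiYdd C) c
            (isOpen_stabilizer_units C) (finiteIndex_stabilizer_units C) ((nonzeroIntegers ℚ_[p] (PadicAlgCl p)).comap (Units.coeHom (PadicAlgCl p))))
          iota).thetaEnv i₀)
    (R : Lbl → (((thetaEnvData C hC hS hl hp2 hpl hζ mods f hf hmods h15 L hZ hcharY hlim).toRecord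
          (h1LimConjMulAut (phi C) (D.lDeltaTheta l) (PiYdd C)) (h1LimKummerOn (phi C) (D.lDeltaTheta l) (PiYdd C) c
            (isOpen_stabilizer_units C) (finiteIndex_stabilizer_units C) ((nonzeroIntegers ℚ_[p] (PadicAlgCl p)).comap (Units.coeHom (PadicAlgCl p))))
          iota).H →*
      Multiplicative (h1Lim φ₀ (D.lDeltaTheta l) (⊤ : Subgroup P₀) ⊥)))
    (hR : ∀ t y, Multiplicative.toAdd (R t y) =
      h1LimComapAct (phi C) (D.lDeltaTheta l) ((MonoidHom.id (Pi C)).comp (s t)) (hι t) φ₀ (hφAct t) (hN t)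
        (AddEquiv.additiveMultiplicative (h1Lim (phi C) (D.lDeltaTheta l) (PiYdd C) ⊥) (Additive.ofMul y)))
    (t₀ : Lbl) (g : P₀) {x : Lbl → ((nonzeroIntegers ℚ_[p] (PadicAlgCl p)).comap (Units.coeHom (PadicAlgCl p)))}
    (hx : (fun t => R t (h1LimKummerOn (phi C) (D.lDeltaTheta l) (PiYdd C) c (isOpen_stabilizer_units C)
        (finiteIndex_stabilizer_units C) ((nonzeroIntegers ℚ_[p] (PadicAlgCl p)).comap (Units.coeHom (PadicAlgCl p))) (x t))) ∈
      MonoidHom.mrange (MonoidHom.pi fun t => (R t).comp (splitMonoid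
        ((thetaEnvData C hC hS hl hp2 hpl hζ mods f hf hmods h15 L hZ hcharY hlim).toRecord
          (h1LimConjMulAut (phi C) (D.lDeltaTheta l) (PiYdd C)) (h1LimKummerOn (phi C) (D.lDeltaTheta l) (PiYdd C) c
            (isOpen_stabilizer_units C) (finiteIndex_stabilizer_units C) ((nonzeroIntegers ℚ_[p] (PadicAlgCl p)).comap (Units.coeHom (PadicAlgCl p))))
          iota).units (Submonoid.powers θ)).subtype)) :
    (fun t => R t (h1LimKummerOn (phi C) (D.lDeltaTheta l) (PiYdd C) c (isOpen_stabilizer_units C)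
        (finiteIndex_stabilizer_units C) ((nonzeroIntegers ℚ_[p] (PadicAlgCl p)).comap (Units.coeHom (PadicAlgCl p)))
        ⟨(s t g) • ((x t : ((nonzeroIntegers ℚ_[p] (PadicAlgCl p)).comap (Units.coeHom (PadicAlgCl p)))) : (PadicAlgCl p)ˣ),
          smul_mem_comap_nonzeroIntegers_padic C (s t g) (x t).2⟩)) ∈
      MonoidHom.mrange (MonoidHom.pi fun t => (R t).comp (splitMonoid
        ((thetaEnvData C hC hS hl hp2 hpl hζ mods f hf hmods h15 L hZ hcharY hlim).toRecord
          (h1LimConjMulAut (phi C) (D.lDeltaTheta l) (PiYdd C)) (h1LimKummerOn (phi C) (D.lDeltaTheta l) (PiYdd C) c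
            (isOpen_stabilizer_units C) (finiteIndex_stabilizer_units C) ((nonzeroIntegers ℚ_[p] (PadicAlgCl p)).comap (Units.coeHom (PadicAlgCl p))))
          iota).units (Submonoid.powers θ)).subtype) :=
  cor36ii_psi_toRecord_act_family_of_mem_thetaEnv C hC hS hl hp2 hpl hζ mods f hf hmods h15 L hZ hcharY hlim c
    (isOpen_stabilizer_units C) (finiteIndex_stabilizer_units C)
    ((nonzeroIntegers ℚ_[p] (PadicAlgCl p)).comap (Units.coeHom (PadicAlgCl p)))
    (fun σ _ hb => smul_mem_comap_nonzeroIntegers_padic C σ hb) iota φ₀ s hι hN hφAct (aug C)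
    (fun _ hy a _ => smul_eq_self_of_aug_eq_one C hy a) w hsec hθ R hR t₀ g hx

/-- **[IUTchII] Cor 3.6 (ii) «↷», `∞`-LEVEL UP TO TORSION, at the genuine `θ_env` data with ANY inversion family and PRINT'S constant
monoid `O := 𝒪^▷_{ℚ̄_p} ≤ ℚ̄_pˣ` through `ε`, every model-data input DISCHARGED** (`(c, hc)` from the chain tower, `hOtors`, `hOroot`,
`hO`, `hq := ε`, `hlim`): there is a bijective coefficient datum `c`, pinned by the level formula `(mods M).red (c ζ) = ζ_M`, such that
for every inversion family `iota`, every `θ ∈ θ^{i₀}_env(𝕄_*)`, every label `i` with print's root condition `hroots` relative to `θ`,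
every family of continuous evaluation sections `s_t` landing in `Π^tp_{Ÿ̲̲}` with common `φ₀` that are sections of `ε` up to one
identification `w`, and every tuple `y : Lbl → 𝒪^▷_{ℚ̄_p}` whose labeled Kummer classes lie in `∏ R_t(∞Ψ^{i}_env)`, the translate
`(s_t(g) · y_t)_t` lies there again up to a family of ROOTS OF UNITY. [claim: Mochizuki2012, status: disputed]
(IUTchII §3 Cor 3.6 (ii), kurims p.100) -/
theorem cor36ii_infty_toRecord_act_family_nonzeroIntegers_of_cyclotomeTower_rigid (hO' : D.IsEtThOrigin)
    (hΔ : IsCompact (D.DeltaTheta : Set D.GtpTheta)) (w : P₀ →* Literature.AnabelianGeometry.SemiGraphs.GQp p)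
    (hsec : ∀ t g, aug C (s t g) = w g) :
    ∃ c : CyclotomeCoefficients (phi C) (D.lDeltaTheta l) (PadicAlgCl p)ˣ,
      Function.Bijective c.hom ∧
      (∀ (ζ : Literature.AnabelianGeometry.EtaleTheta.cyclotome (PadicAlgCl p)ˣ) (M : ℕ+),
        (((mods M).red (c.hom ζ) : MuN p M) : (PadicAlgCl p)ˣ) = (ζ : ℕ+ → (PadicAlgCl p)ˣ) M) ∧
      ∀ {Iota : Type}
        (iota : Iota → ((thetaEnvData C hC hS hl hp2 hpl hζ mods f hf hmods h15 L hZ hcharY (bijective_rigidLimHom C hC hS hl hp2 hpl hζ mods f hf hmods h15 L hZ)).D.coh.lim ≃+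
          (thetaEnvData C hC hS hl hp2 hpl hζ mods f hf hmods h15 L hZ hcharY (bijective_rigidLimHom C hC hS hl hp2 hpl hζ mods f hf hmods h15 L hZ)).D.coh.lim))
        {i₀ : Iota}
        {θ : ((thetaEnvData C hC hS hl hp2 hpl hζ mods f hf hmods h15 L hZ hcharY (bijective_rigidLimHom C hC hS hl hp2 hpl hζ mods f hf hmods h15 L hZ)).toRecord
          (h1LimConjMulAut (phi C) (D.lDeltaTheta l) (PiYdd C)) (h1LimKummerOn (phi C) (D.lDeltaTheta l) (PiYdd C) c
            (isOpen_stabilizer_units C) (finiteIndex_stabilizer_units C) ((nonzeroIntegers ℚ_[p] (PadicAlgCl p)).comap (Units.coeHom (PadicAlgCl p))))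
          iota).H},
        θ ∈ ((thetaEnvData C hC hS hl hp2 hpl hζ mods f hf hmods h15 L hZ hcharY (bijective_rigidLimHom C hC hS hl hp2 hpl hζ mods f hf hmods h15 L hZ)).toRecord
          (h1LimConjMulAut (phi C) (D.lDeltaTheta l) (PiYdd C)) (h1LimKummerOn (phi C) (D.lDeltaTheta l) (PiYdd C) c
            (isOpen_stabilizer_units C) (finiteIndex_stabilizer_units C) ((nonzeroIntegers ℚ_[p] (PadicAlgCl p)).comap (Units.coeHom (PadicAlgCl p))))
          iota).thetaEnv i₀ →
        ∀ (i : ((thetaEnvData C hC hS hl hp2 hpl hζ mods f hf hmods h15 L hZ hcharY (bijective_rigidLimHom C hC hS hl hp2 hpl hζ mods f hf hmods h15 L hZ)).toRecord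
          (h1LimConjMulAut (phi C) (D.lDeltaTheta l) (PiYdd C)) (h1LimKummerOn (phi C) (D.lDeltaTheta l) (PiYdd C) c
            (isOpen_stabilizer_units C) (finiteIndex_stabilizer_units C) ((nonzeroIntegers ℚ_[p] (PadicAlgCl p)).comap (Units.coeHom (PadicAlgCl p))))
          iota).Iota),
        (∀ ϑ ∈ ((thetaEnvData C hC hS hl hp2 hpl hζ mods f hf hmods h15 L hZ hcharY (bijective_rigidLimHom C hC hS hl hp2 hpl hζ mods f hf hmods h15 L hZ)).toRecord
          (h1LimConjMulAut (phi C) (D.lDeltaTheta l) (PiYdd C)) (h1LimKummerOn (phi C) (D.lDeltaTheta l) (PiYdd C) c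
            (isOpen_stabilizer_units C) (finiteIndex_stabilizer_units C) ((nonzeroIntegers ℚ_[p] (PadicAlgCl p)).comap (Units.coeHom (PadicAlgCl p))))
          iota).inftyThetaEnv i,
          ∃ n : ℕ, 0 < n ∧ ϑ ^ n ∈
            splitMonoid ((thetaEnvData C hC hS hl hp2 hpl hζ mods f hf hmods h15 L hZ hcharY (bijective_rigidLimHom C hC hS hl hp2 hpl hζ mods f hf hmods h15 L hZ)).toRecord
          (h1LimConjMulAut (phi C) (D.lDeltaTheta l) (PiYdd C)) (h1LimKummerOn (phi C) (D.lDeltaTheta l) (PiYdd C) c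
            (isOpen_stabilizer_units C) (finiteIndex_stabilizer_units C) ((nonzeroIntegers ℚ_[p] (PadicAlgCl p)).comap (Units.coeHom (PadicAlgCl p))))
          iota).units (Submonoid.powers θ)) →
        ∀ (R : Lbl → (((thetaEnvData C hC hS hl hp2 hpl hζ mods f hf hmods h15 L hZ hcharY (bijective_rigidLimHom C hC hS hl hp2 hpl hζ mods f hf hmods h15 L hZ)).toRecord
          (h1LimConjMulAut (phi C) (D.lDeltaTheta l) (PiYdd C)) (h1LimKummerOn (phi C) (D.lDeltaTheta l) (PiYdd C) c
            (isOpen_stabilizer_units C) (finiteIndex_stabilizer_units C) ((nonzeroIntegers ℚ_[p] (PadicAlgCl p)).comap (Units.coeHom (PadicAlgCl p))))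
          iota).H →* Multiplicative (h1Lim φ₀ (D.lDeltaTheta l) (⊤ : Subgroup P₀) ⊥))),
          (∀ t y, Multiplicative.toAdd (R t y) =
            h1LimComapAct (phi C) (D.lDeltaTheta l) ((MonoidHom.id (Pi C)).comp (s t)) (hι t) φ₀ (hφAct t) (hN t)
              (AddEquiv.additiveMultiplicative (h1Lim (phi C) (D.lDeltaTheta l) (PiYdd C) ⊥) (Additive.ofMul y))) →
          ∀ (t₀ : Lbl) (g : P₀) {y : Lbl → ((nonzeroIntegers ℚ_[p] (PadicAlgCl p)).comap (Units.coeHom (PadicAlgCl p)))},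
            (fun t => R t (h1LimKummerOn (phi C) (D.lDeltaTheta l) (PiYdd C) c (isOpen_stabilizer_units C)
        (finiteIndex_stabilizer_units C) ((nonzeroIntegers ℚ_[p] (PadicAlgCl p)).comap (Units.coeHom (PadicAlgCl p))) (y t))) ∈
              (((thetaEnvData C hC hS hl hp2 hpl hζ mods f hf hmods h15 L hZ hcharY (bijective_rigidLimHom C hC hS hl hp2 hpl hζ mods f hf hmods h15 L hZ)).toRecord
          (h1LimConjMulAut (phi C) (D.lDeltaTheta l) (PiYdd C)) (h1LimKummerOn (phi C) (D.lDeltaTheta l) (PiYdd C) c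
            (isOpen_stabilizer_units C) (finiteIndex_stabilizer_units C) ((nonzeroIntegers ℚ_[p] (PadicAlgCl p)).comap (Units.coeHom (PadicAlgCl p))))
          iota).inftyThetaMonoid i).map (MonoidHom.pi R) →
            ∃ v : Lbl → ((nonzeroIntegers ℚ_[p] (PadicAlgCl p)).comap (Units.coeHom (PadicAlgCl p))),
              (∀ t, IsOfFinOrder (v t)) ∧
              (fun t => R t (h1LimKummerOn (phi C) (D.lDeltaTheta l) (PiYdd C) c (isOpen_stabilizer_units C)
        (finiteIndex_stabilizer_units C) ((nonzeroIntegers ℚ_[p] (PadicAlgCl p)).comap (Units.coeHom (PadicAlgCl p)))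
                  (v t * ⟨(s t g) • ((y t : ((nonzeroIntegers ℚ_[p] (PadicAlgCl p)).comap (Units.coeHom (PadicAlgCl p)))) :
                      (PadicAlgCl p)ˣ), smul_mem_comap_nonzeroIntegers_padic C (s t g) (y t).2⟩))) ∈
                (((thetaEnvData C hC hS hl hp2 hpl hζ mods f hf hmods h15 L hZ hcharY (bijective_rigidLimHom C hC hS hl hp2 hpl hζ mods f hf hmods h15 L hZ)).toRecord
          (h1LimConjMulAut (phi C) (D.lDeltaTheta l) (PiYdd C)) (h1LimKummerOn (phi C) (D.lDeltaTheta l) (PiYdd C) c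
            (isOpen_stabilizer_units C) (finiteIndex_stabilizer_units C) ((nonzeroIntegers ℚ_[p] (PadicAlgCl p)).comap (Units.coeHom (PadicAlgCl p))))
          iota).inftyThetaMonoid i).map (MonoidHom.pi R) := by
  obtain ⟨c, hc, hlev⟩ := exists_cyclotomeCoefficients_mods C mods hmods hO' hΔ
  refine ⟨c, hc, hlev, fun {Iota} iota {i₀} {θ} hθ i hroots R hR t₀ g y hy => ?_⟩
  exact cor36ii_infty_toRecord_act_family_of_mem_thetaEnv C hC hS hl hp2 hpl hζ mods f hf hmods h15 L hZ hcharY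
    (bijective_rigidLimHom C hC hS hl hp2 hpl hζ mods f hf hmods h15 L hZ) c (isOpen_stabilizer_units C)
    (finiteIndex_stabilizer_units C) ((nonzeroIntegers ℚ_[p] (PadicAlgCl p)).comap (Units.coeHom (PadicAlgCl p)))
    (fun σ _ hb => smul_mem_comap_nonzeroIntegers_padic C σ hb) iota φ₀ s hι hN hφAct hc
    (fun a ha => ⟨mem_comap_nonzeroIntegers_padic_of_isOfFinOrder' ha,
      mem_comap_nonzeroIntegers_padic_of_isOfFinOrder' ha.inv⟩)
    (fun _ _ hn ha => mem_comap_nonzeroIntegers_of_pow_mem hn ha) (aug C)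
    (fun _ hy' a _ => smul_eq_self_of_aug_eq_one C hy' a) w hsec hθ i hroots R hR t₀ g hy

end TowerAct

/-! ### §2. The pair family with `hroots` discharged (p441065, action-level junction) -/

section PairCtx

variable {p : ℕ} [Fact p.Prime] {D : Literature.AnabelianGeometry.EtaleTheta.ThetaSetting p}
  {E : D.EtaleThetaData} {l : ℕ} (C : E.DoubleUnderline l) (hC : D.Compat) (hS : D.Sec2Hyps)
  (hl : l.Prime) (hp2 : p ≠ 2) (hpl : p ≠ l) (hζ : ∃ ζ : D.K, IsPrimitiveRoot ζ (4 * l))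
  (mods : ∀ M : ℕ+, D.CyclotomeMod l M)
  (f : contCocycles D.toTheta D.DeltaTheta C.GtpYdduu) (hf : f ∈ C.rootCocycles hC)
  (hmods : ∀ (M M' : ℕ+) (h : (M : ℕ) ∣ (M' : ℕ)) (x : D.lDeltaTheta l),
    MuN.red p M M' h ((mods M').red x) = (mods M).red x)
  (h15 : Literature.AnabelianGeometry.EtaleTheta.ThetaSetting.Prop15iii E hC) (L : C.CuspLabels)
  (hZ : ∀ M : ℕ+, Nonempty (ModelCyclotomes.lDeltaQuot (C.rigidData (mods M) hC hS h15 L) ≃*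
    Literature.IUT.HodgeTheaters.ZHat))
  (hcharY : EtaleThetaDataOfSetting.PiYddCharacteristic C)
  [(EtaleThetaDataOfSetting.PiYdd C).Normal]

section FamilyActPair

variable {Lbl : Type*} {P₀ : TopGroup.{0}} (φ₀ : P₀ →* D.GtpTheta) (s : Lbl → (P₀ →* Pi C))
  (hι : ∀ t, Continuous ((MonoidHom.id (Pi C)).comp (s t)))
  (hN : ∀ t, (⊤ : Subgroup P₀).map ((MonoidHom.id (Pi C)).comp (s t)) ≤ PiYdd C)
  -- THE ACTION-LEVEL JUNCTION (replaces `hφ : ∀ t, (phi C).comp (s t) = φ₀`)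
  (hφAct : ∀ (t : Lbl) (g : P₀) (a : D.lDeltaTheta l),
    MulAut.conjNormal (phi C (((MonoidHom.id (Pi C)).comp (s t)) g)) a = MulAut.conjNormal (φ₀ g) a)

include hmods in
/-- **[IUTchII] Cor 3.6 (ii) «↷», `∞`-LEVEL UP TO TORSION, at the genuine `θ_env` data with PRINT'S constant monoid `O := 𝒪^▷_{ℚ̄_p}`
through `ε`, every model-data input discharged, ACTION-LEVEL junction `hφAct` (§1's `cor36ii_infty_toRecord_act_family_nonzeroIntegers_of_cyclotomeTower_rigid`)
— with print's root condition `hroots` DISCHARGED** for any inversion family whose `i₀`-th member is the pair action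
`pairRhoLim C αι βι …`: there is a bijective coefficient datum `c`, pinned by the level formula, such that for every such `iota`, every
`θ ∈ θ^{i₀}_env(𝕄_*)`, every family of continuous evaluation sections `s_t` (common `φ₀`, sections of `ε` up to `w`) and every tuple
`y : Lbl → 𝒪^▷_{ℚ̄_p}` with labeled Kummer classes in `∏ R_t(∞Ψ^{i₀}_env)`, the translate `(s_t(g) · y_t)_t` lies there again up to a family
of ROOTS OF UNITY. Remaining inputs: (R1)(R2)(R3) of [IUTchII] Prop 2.2 (ii) at the model, `IsEtThOrigin`, `IsCompact Δ_Θ`.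
[claim: Mochizuki2012, status: disputed] (IUTchII §3 Cor 3.6 (ii), kurims p.100) -/
theorem cor36ii_infty_toRecord_act_family_nonzeroIntegers_pairRhoLim (hO' : D.IsEtThOrigin)
    (hΔ : IsCompact (D.DeltaTheta : Set D.GtpTheta)) (w : P₀ →* Literature.AnabelianGeometry.SemiGraphs.GQp p)
    (hsec : ∀ t g, aug C (s t g) = w g)
    -- (R1) the pointed-inversion PAIR, reversing the `ℤ`-torsor
    (αι : (Pi C) ≃ₜ* (Pi C)) (βι : D.GtpTheta ≃ₜ* D.GtpTheta) (hφαβ : ∀ g, βι (phi C g) = phi C (αι g))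
    (hAβ : ∀ a : D.GtpTheta, a ∈ D.lDeltaTheta l ↔ βι a ∈ D.lDeltaTheta l)
    (hH : ∀ x, x ∈ PiYdd C ↔ αι x ∈ PiYdd C)
    (γ ε : Pi C) (hγ : C.toLZ γ = Multiplicative.ofAdd 1) (hε₁ : (ε : D.PiTemp) ∈ D.GtpY)
    (hε₂ : (ε : D.PiTemp) ∉ D.GtpYdd) (hαγ : C.toLZ (αι γ) = Multiplicative.ofAdd (-1))
    -- (R2)(R3) [EtTh] Prop 1.4 at the class level
    (hsign : ∃ κ : ContH1 (phi C) (D.lDeltaTheta l) (PiYdd C ⊓ ⊤), κ ^ 2 = 1 ∧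
      ContH1.conj (phi C) (D.lDeltaTheta l) ε (rootLiftClass C) = rootLiftClass C * κ)
    (hroot : ∃ τ₀ : Pi C, (τ₀ : D.PiTemp) ∈ D.GtpY ∧
      h1TopAut (phi C) (D.lDeltaTheta l) (PiYdd C) αι βι hφαβ (fun a ha => (hAβ a).mp ha) hH (rootLiftClass C) =
        ContH1.conj (phi C) (D.lDeltaTheta l) τ₀ (rootLiftClass C))
    (hfree : ∀ m n : ℤ, IsOfFinAddOrder
      ((h1Top C).symm (Additive.ofMul (ContH1.conj (phi C) (D.lDeltaTheta l) (γ ^ m) (rootLiftClass C))) -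
        (h1Top C).symm (Additive.ofMul (ContH1.conj (phi C) (D.lDeltaTheta l) (γ ^ n) (rootLiftClass C)))) →
      m = n) :
    ∃ c : CyclotomeCoefficients (phi C) (D.lDeltaTheta l) (PadicAlgCl p)ˣ,
      Function.Bijective c.hom ∧
      (∀ (ζ : Literature.AnabelianGeometry.EtaleTheta.cyclotome (PadicAlgCl p)ˣ) (M : ℕ+),
        (((mods M).red (c.hom ζ) : MuN p M) : (PadicAlgCl p)ˣ) = (ζ : ℕ+ → (PadicAlgCl p)ˣ) M) ∧
      ∀ {Iota : Type}
        (iota : Iota → ((thetaEnvData C hC hS hl hp2 hpl hζ mods f hf hmods h15 L hZ hcharY (bijective_rigidLimHom C hC hS hl hp2 hpl hζ mods f hf hmods h15 L hZ)).D.coh.lim ≃+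
          (thetaEnvData C hC hS hl hp2 hpl hζ mods f hf hmods h15 L hZ hcharY (bijective_rigidLimHom C hC hS hl hp2 hpl hζ mods f hf hmods h15 L hZ)).D.coh.lim))
        {i₀ : Iota} (_ : iota i₀ = pairRhoLim C αι βι hφαβ hAβ hH)
        {θ : ((thetaEnvData C hC hS hl hp2 hpl hζ mods f hf hmods h15 L hZ hcharY (bijective_rigidLimHom C hC hS hl hp2 hpl hζ mods f hf hmods h15 L hZ)).toRecord
          (h1LimConjMulAut (phi C) (D.lDeltaTheta l) (PiYdd C)) (h1LimKummerOn (phi C) (D.lDeltaTheta l) (PiYdd C) c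
            (isOpen_stabilizer_units C) (finiteIndex_stabilizer_units C) ((nonzeroIntegers ℚ_[p] (PadicAlgCl p)).comap (Units.coeHom (PadicAlgCl p))))
          iota).H},
        θ ∈ ((thetaEnvData C hC hS hl hp2 hpl hζ mods f hf hmods h15 L hZ hcharY (bijective_rigidLimHom C hC hS hl hp2 hpl hζ mods f hf hmods h15 L hZ)).toRecord
          (h1LimConjMulAut (phi C) (D.lDeltaTheta l) (PiYdd C)) (h1LimKummerOn (phi C) (D.lDeltaTheta l) (PiYdd C) c
            (isOpen_stabilizer_units C) (finiteIndex_stabilizer_units C) ((nonzeroIntegers ℚ_[p] (PadicAlgCl p)).comap (Units.coeHom (PadicAlgCl p))))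
          iota).thetaEnv i₀ →
        ∀ (R : Lbl → (((thetaEnvData C hC hS hl hp2 hpl hζ mods f hf hmods h15 L hZ hcharY (bijective_rigidLimHom C hC hS hl hp2 hpl hζ mods f hf hmods h15 L hZ)).toRecord
          (h1LimConjMulAut (phi C) (D.lDeltaTheta l) (PiYdd C)) (h1LimKummerOn (phi C) (D.lDeltaTheta l) (PiYdd C) c
            (isOpen_stabilizer_units C) (finiteIndex_stabilizer_units C) ((nonzeroIntegers ℚ_[p] (PadicAlgCl p)).comap (Units.coeHom (PadicAlgCl p))))
          iota).H →* Multiplicative (h1Lim φ₀ (D.lDeltaTheta l) (⊤ : Subgroup P₀) ⊥))),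
          (∀ t y, Multiplicative.toAdd (R t y) =
            h1LimComapAct (phi C) (D.lDeltaTheta l) ((MonoidHom.id (Pi C)).comp (s t)) (hι t) φ₀ (hφAct t) (hN t)
              (AddEquiv.additiveMultiplicative (h1Lim (phi C) (D.lDeltaTheta l) (PiYdd C) ⊥) (Additive.ofMul y))) →
          ∀ (t₀ : Lbl) (g : P₀) {y : Lbl → ((nonzeroIntegers ℚ_[p] (PadicAlgCl p)).comap (Units.coeHom (PadicAlgCl p)))},
            (fun t => R t (h1LimKummerOn (phi C) (D.lDeltaTheta l) (PiYdd C) c (isOpen_stabilizer_units C)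
        (finiteIndex_stabilizer_units C) ((nonzeroIntegers ℚ_[p] (PadicAlgCl p)).comap (Units.coeHom (PadicAlgCl p))) (y t))) ∈
              (((thetaEnvData C hC hS hl hp2 hpl hζ mods f hf hmods h15 L hZ hcharY (bijective_rigidLimHom C hC hS hl hp2 hpl hζ mods f hf hmods h15 L hZ)).toRecord
          (h1LimConjMulAut (phi C) (D.lDeltaTheta l) (PiYdd C)) (h1LimKummerOn (phi C) (D.lDeltaTheta l) (PiYdd C) c
            (isOpen_stabilizer_units C) (finiteIndex_stabilizer_units C) ((nonzeroIntegers ℚ_[p] (PadicAlgCl p)).comap (Units.coeHom (PadicAlgCl p))))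
          iota).inftyThetaMonoid i₀).map (MonoidHom.pi R) →
            ∃ v : Lbl → ((nonzeroIntegers ℚ_[p] (PadicAlgCl p)).comap (Units.coeHom (PadicAlgCl p))),
              (∀ t, IsOfFinOrder (v t)) ∧
              (fun t => R t (h1LimKummerOn (phi C) (D.lDeltaTheta l) (PiYdd C) c (isOpen_stabilizer_units C)
        (finiteIndex_stabilizer_units C) ((nonzeroIntegers ℚ_[p] (PadicAlgCl p)).comap (Units.coeHom (PadicAlgCl p)))
                  (v t * ⟨(s t g) • ((y t : ((nonzeroIntegers ℚ_[p] (PadicAlgCl p)).comap (Units.coeHom (PadicAlgCl p)))) :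
                      (PadicAlgCl p)ˣ), smul_mem_comap_nonzeroIntegers_padic C (s t g) (y t).2⟩))) ∈
                (((thetaEnvData C hC hS hl hp2 hpl hζ mods f hf hmods h15 L hZ hcharY (bijective_rigidLimHom C hC hS hl hp2 hpl hζ mods f hf hmods h15 L hZ)).toRecord
          (h1LimConjMulAut (phi C) (D.lDeltaTheta l) (PiYdd C)) (h1LimKummerOn (phi C) (D.lDeltaTheta l) (PiYdd C) c
            (isOpen_stabilizer_units C) (finiteIndex_stabilizer_units C) ((nonzeroIntegers ℚ_[p] (PadicAlgCl p)).comap (Units.coeHom (PadicAlgCl p))))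
          iota).inftyThetaMonoid i₀).map (MonoidHom.pi R) := by
  obtain ⟨c, hc, hlev⟩ := exists_cyclotomeCoefficients_mods C mods hmods hO' hΔ
  refine ⟨c, hc, hlev, fun {Iota} iota {i₀} hi₀ {θ} hθ R hR t₀ g y hy => ?_⟩
  exact cor36ii_infty_toRecord_act_family_of_mem_thetaEnv C hC hS hl hp2 hpl hζ mods f hf hmods h15 L hZ hcharY
    (bijective_rigidLimHom C hC hS hl hp2 hpl hζ mods f hf hmods h15 L hZ) c (isOpen_stabilizer_units C)
    (finiteIndex_stabilizer_units C) ((nonzeroIntegers ℚ_[p] (PadicAlgCl p)).comap (Units.coeHom (PadicAlgCl p)))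
    (fun σ _ hb => smul_mem_comap_nonzeroIntegers_padic C σ hb) iota φ₀ s hι hN hφAct hc
    (fun _ ha => ⟨mem_comap_nonzeroIntegers_padic_of_isOfFinOrder' ha,
      mem_comap_nonzeroIntegers_padic_of_isOfFinOrder' ha.inv⟩)
    (fun _ _ hn ha => mem_comap_nonzeroIntegers_of_pow_mem hn ha) (aug C)
    (fun _ hy' a _ => smul_eq_self_of_aug_eq_one C hy' a) w hsec hθ i₀
    (hroots_toRecord_pairRhoLim C hC hS hl hp2 hpl hζ mods f hf hmods h15 L hZ hcharY
      (bijective_rigidLimHom C hC hS hl hp2 hpl hζ mods f hf hmods h15 L hZ) c (isOpen_stabilizer_units C)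
      (finiteIndex_stabilizer_units C) ((nonzeroIntegers ℚ_[p] (PadicAlgCl p)).comap (Units.coeHom (PadicAlgCl p))) iota hc
      (fun _ ha => ⟨mem_comap_nonzeroIntegers_padic_of_isOfFinOrder' ha,
        mem_comap_nonzeroIntegers_padic_of_isOfFinOrder' ha.inv⟩)
      αι βι hφαβ hAβ hH γ ε hγ hε₁ hε₂ hαγ hsign hroot hfree (hker_coh_of_mods C mods hmods hO') hi₀ hθ)
    R hR t₀ g hy


end FamilyActPair

end PairCtx

end EtaleLevels

end Literature.IUT.HodgeArakelov

end
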